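import Summits.MatrixMultiplication.OmegaCensus.SmallFormats.GF2OrbitSweepLP
import HarnessLib

/-!
# ω-census family (a): the extended (LP) orbit sweep — obligations, split machinery, projections (part 2 of the G3 checker)

Cell `pub-mm22` (MatrixMultiplication venture, Route D3-STRETCH `⟨3,3,3⟩/𝔽₂`), topic `Summits/MatrixMultiplication/OmegaCensus`
(sub-folder `SmallFormats`). HAND-OVER SNIPPET written by seat LIT-2 g3 (HOME/lit/d3-333/lean-snippets/GF2OrbitSweepLP.lean),
landed by p3 g2 split in two at the gate's 400-line limit; this is the second half, verbatim: residual obligations in data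
files (`noForcedBX`, `obligsX_of_noForced`, `obligsX_of_forced_cons`), the split of an orbit check into Boolean side
conditions + per-piece root checks + the chain (`stepSideX`, `stepValX`, `stepNX`, `rootCheckBX`, `RootsOKX`, `chainBX`,
`rootsOKX_of_forall`, `stepBoundX_eq_of_side`, `le_foldl_of_chainBX`, `orbitCheckX_of_chain`), tree splitting (`kidOfM`,
`isNodeBM`, `checkM_of_kidOf`) and the projections (`tabOfX`, `tabTOfX`, `tgtOfX`, `candNX`, `rootsOfX`, `rootCheckBX_eq_dfsLP`).
HONEST FRAMING: checker plumbing for a kernel replay of published numbers; PROVED, no new bound, not progress on `ω`.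
-/

namespace Summit.MatrixMultiplication.OmegaCensus.GF2RankLB

open Module Matrix Literature.Computability.AlgebraicComplexity

variable (l n : ℕ)

/-! ## Obligations in data files -/

/-- No basic forced-product step in the list. -/
def noForcedBX : List StepX → Bool
  | [] => true
  | .old (.forced _ _ _ _ _) :: _ => false
  | _ :: rest => noForcedBX rest

/-- Steps without forced products carry no obligation. -/
theorem stepXOblig_of_noForced {l n : ℕ} : ∀ steps : List StepX, noForcedBX steps = true →
    ∀ st ∈ steps, StepXOblig l n st
  | [], _, st, hst => by simp at hst
  | st' :: rest, h, st, hst => by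
    have hrest : noForcedBX rest = true ∧ StepXOblig l n st' := by
      cases st' with
      | old st'' =>
        cases st'' with
        | forced => simp [noForcedBX] at h
        | _ => exact ⟨by simpa [noForcedBX] using h, trivial⟩
      | _ => exact ⟨by simpa [noForcedBX] using h, trivial⟩
    rcases List.mem_cons.1 hst with rfl | hmem
    · exact hrest.2
    · exact stepXOblig_of_noForced rest hrest.1 st hmem

/-- Obligations of an orbit without forced-product steps. -/
theorem obligsX_of_noForced {l n : ℕ} (os : List OrbitX) (i : ℕ)
    (h : noForcedBX (os.getD i default).steps = true) : ObligsX l n os i :=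
  stepXOblig_of_noForced _ h

/-- Obligations of an orbit whose first step is its only forced product. -/
theorem obligsX_of_forced_cons {l n : ℕ} (os : List OrbitX) (i : ℕ) (ts ws cs xs sel : List ℕ)
    (rest : List StepX) (h : (os.getD i default).steps = StepX.old (Step.forced ts ws cs xs sel) :: rest)
    (hr : ResidualsOK l n ts ws cs xs sel) (hrest : noForcedBX rest = true) : ObligsX l n os i := by
  intro st hst
  rw [h] at hst
  rcases List.mem_cons.1 hst with rfl | hmem
  · exact hr
  · exact stepXOblig_of_noForced rest hrest st hmem

/-! ## Splitting an orbit check: side conditions, root checks, chain -/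

/-- The side conditions of an extended step (everything except DFS root checks and the LP-leaf test). -/
def stepSideX (os : List OrbitX) (i : ℕ) (K : List ℕ) (cur : ℕ) : StepX → Bool
  | .old st => stepSide l l n (coreOf os) i K cur st
  | .lookT extra j P Pi Q Qi => decide (j < i) && sandTB l (kOf (coreOf os) j) (K ++ extra) P Pi Q Qi
  | .lp cands _ table tableT _ _ =>
      coverB l l K cands && tableOK l l (coreOf os) i K cands table && tableTOK l (coreOf os) i K cands tableT
  | .dfsLP cands target x b c table tableT _ =>
      decide (target ≤ cur + 1) && nzB l l n K x b c && coverB l l K cands &&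
        tableOK l l (coreOf os) i K cands table && tableTOK l (coreOf os) i K cands tableT

/-- The value an extended step certifies when it passes. -/
def stepValX (os : List OrbitX) : StepX → ℕ
  | .old st => stepVal (coreOf os) st
  | .lookT _ j _ _ _ _ => bnd (coreOf os) j
  | .lp _ target _ _ _ _ => target
  | .dfsLP _ target _ _ _ _ _ _ => target

/-- Number of separately checked pieces of a step: DFS roots, or `1` for an LP leaf at the root. -/
def stepNX : StepX → ℕ
  | .old st => stepN st
  | .lp _ _ _ _ _ _ => 1
  | .dfsLP cands _ _ _ _ _ _ _ => cands.length
  | .lookT _ _ _ _ _ _ => 0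

/-- The `k`-th separately checked piece of a step (vacuous when out of range). -/
def rootCheckBX (os : List OrbitX) : StepX → ℕ → Bool
  | .old st, k => rootCheckB (coreOf os) st k
  | .lp cands target table tableT rows D, _ =>
      lpLeafMB (fun fm => lbOf2 (coreOf os) table tableT (setOf cands.length fm)) target rows D 0
        (Fin.elim0 : Fin 0 → Fin cands.length)
  | .dfsLP cands target _ _ _ table tableT roots, k =>
      if h : k < cands.length then
        (roots ⟨k, h⟩).check (fun fm => lbOf2 (coreOf os) table tableT (setOf cands.length fm))
          target (target - 1) 1 (fun _ => ⟨k, h⟩)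
      else true
  | .lookT _ _ _ _ _ _, _ => true

/-- All separately checked pieces of a step pass. -/
def RootsOKX (os : List OrbitX) : StepX → Prop
  | .old st => RootsOK (coreOf os) st
  | .lp cands target table tableT rows D =>
      lpLeafMB (fun fm => lbOf2 (coreOf os) table tableT (setOf cands.length fm)) target rows D 0
        (Fin.elim0 : Fin 0 → Fin cands.length) = true
  | .dfsLP cands target _ _ _ table tableT roots =>
      ∀ mm : Fin cands.length,
        (roots mm).check (fun fm => lbOf2 (coreOf os) table tableT (setOf cands.length fm))
          target (target - 1) 1 (fun _ => mm) = true
  | .lookT _ _ _ _ _ _ => True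

/-- Root checks of all steps of a list (positional conjunction, `True`-terminated). -/
def StepsRootsOKX (os : List OrbitX) : List StepX → Prop
  | [] => True
  | st :: rest => RootsOKX os st ∧ StepsRootsOKX os rest

/-- The chain of side conditions with the running bound, ending in the claimed bound. -/
def chainBX (os : List OrbitX) (i : ℕ) (K : List ℕ) : ℕ → List StepX → Bool
  | cur, [] => decide (bnd (coreOf os) i ≤ cur)
  | cur, st :: rest => stepSideX l n os i K cur st && chainBX os i K (max cur (stepValX os st)) rest

variable {l n}

/-- `RootsOKX` from the per-piece Boolean checks. -/
theorem rootsOKX_of_forall (os : List OrbitX) (st : StepX) (h : ∀ k < stepNX st, rootCheckBX os st k = true) :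
    RootsOKX os st := by
  cases st with
  | old st => exact rootsOK_of_forall (coreOf os) st h
  | lp cands target table tableT rows D => exact h 0 Nat.one_pos
  | dfsLP cands target x b c table tableT roots =>
    intro mm
    have := h mm.1 mm.2
    simpa [rootCheckBX, mm.2] using this
  | lookT => trivial

/-- Under its side conditions and piece checks an extended step certifies exactly `stepValX`. -/
theorem stepBoundX_eq_of_side (os : List OrbitX) (i : ℕ) (K : List ℕ) (cur : ℕ) (st : StepX)
    (h1 : stepSideX l n os i K cur st = true) (h2 : RootsOKX os st) :
    stepBoundX l n os i K cur st = stepValX os st := by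
  cases st with
  | old st => exact stepBound_eq_of_side (coreOf os) i K cur st h1 h2
  | lookT extra j P Pi Q Qi =>
    simp only [stepSideX, Bool.and_eq_true, decide_eq_true_eq] at h1
    simp [stepBoundX, stepValX, h1]
  | lp cands target table tableT rows D =>
    simp only [stepSideX, Bool.and_eq_true] at h1
    obtain ⟨⟨hcov, htab⟩, htabT⟩ := h1
    simp only [stepBoundX, stepValX]
    rw [if_pos ⟨hcov, htab, htabT, h2⟩]
  | dfsLP cands target x b c table tableT roots =>
    simp only [stepSideX, Bool.and_eq_true, decide_eq_true_eq] at h1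
    obtain ⟨⟨⟨⟨ht, hnz⟩, hcov⟩, htab⟩, htabT⟩ := h1
    simp only [stepBoundX, stepValX]
    rw [if_pos ⟨ht, hnz, hcov, htab, htabT, h2⟩]

/-- The chain computes the fold of `orbitBoundX`. -/
theorem le_foldl_of_chainBX (os : List OrbitX) (i : ℕ) (K : List ℕ) :
    ∀ (steps : List StepX) (cur : ℕ), chainBX l n os i K cur steps = true → StepsRootsOKX os steps →
      bnd (coreOf os) i ≤ steps.foldl (fun cur st => max cur (stepBoundX l n os i K cur st)) cur
  | [], cur, h, _ => by simpa [chainBX] using h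
  | st :: rest, cur, h, hr => by
    simp only [chainBX, Bool.and_eq_true] at h
    rw [List.foldl_cons, stepBoundX_eq_of_side os i K cur st h.1 hr.1]
    exact le_foldl_of_chainBX os i K rest _ h.2 hr.2

/-- **Orbit check from the chain and the per-piece lemmas.** -/
theorem orbitCheckX_of_chain (os : List OrbitX) (i : ℕ)
    (h1 : chainBX l n os i (kOf (coreOf os) i) 0 (os.getD i default).steps = true)
    (h2 : StepsRootsOKX os (os.getD i default).steps) : orbitCheckX l n os i = true := by
  simp only [orbitCheckX, orbitBoundX, decide_eq_true_eq]
  exact le_foldl_of_chainBX os i (kOf (coreOf os) i) _ 0 h1 h2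

/-! ## Splitting one LP tree root over its children -/

section TreeSplit

variable {N : ℕ}

/-- The `mm`-th child of a mask tree (a leaf is its own child). -/
def kidOfM : MCert N → Fin N → MCert N
  | .node cs, mm => cs mm
  | .leaf rows D, _ => .leaf rows D

/-- Is the tree an internal node? -/
def isNodeBM : MCert N → Bool
  | .node _ => true
  | .leaf _ _ => false

/-- `kidOfM` of a node. -/
@[simp] theorem kidOfM_node (cs : Fin N → MCert N) (mm : Fin N) : kidOfM (MCert.node cs) mm = cs mm := rfl

/-- **Splitting a node check over its children.** -/
theorem checkM_of_kidOf {LBm : ℕ → ℕ} {target maxDepth d : ℕ} (t : MCert N) (s : Fin d → Fin N)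
    (ht : isNodeBM t = true) (hd : d < maxDepth)
    (hk : ∀ mm : Fin N, (∀ p : Fin d, s p ≤ mm) →
      (kidOfM t mm).check LBm target maxDepth (d + 1) (Fin.snoc s mm) = true) :
    t.check LBm target maxDepth d s = true := by
  cases t with
  | leaf rows D => simp [isNodeBM] at ht
  | node cs =>
    simp only [MCert.check, Bool.and_eq_true, decide_eq_true_eq]
    exact ⟨hd, fun mm hmm => hk mm hmm⟩

end TreeSplit

/-- The plain table of an LP round (`[]` otherwise). -/
def tabOfX : StepX → List LookRow
  | .dfsLP _ _ _ _ _ table _ _ => table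
  | .lp _ _ table _ _ _ => table
  | _ => []

/-- The transposed table of an LP round (`[]` otherwise). -/
def tabTOfX : StepX → List LookRow
  | .dfsLP _ _ _ _ _ _ tableT _ => tableT
  | .lp _ _ _ tableT _ _ => tableT
  | _ => []

/-- The target of an LP round (`0` otherwise). -/
def tgtOfX : StepX → ℕ
  | .dfsLP _ target _ _ _ _ _ _ => target
  | .lp _ target _ _ _ _ => target
  | _ => 0

/-- The number of candidates of an LP round (`0` otherwise). -/
def candNX : StepX → ℕ
  | .dfsLP cands _ _ _ _ _ _ _ => cands.length
  | .lp cands _ _ _ _ _ => cands.length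
  | _ => 0

/-- The root trees of an LP DFS round (a dummy leaf otherwise). -/
def rootsOfX : (st : StepX) → Fin (candNX st) → MCert (candNX st)
  | .dfsLP _ _ _ _ _ _ _ roots, k => roots k
  | .lp _ _ _ _ _ _, _ => .leaf [] 1
  | .old _, k => k.elim0
  | .lookT _ _ _ _ _ _, k => k.elim0

/-- `rootCheckBX` of an LP DFS round in terms of the projections (rewrite target for data files). -/
theorem rootCheckBX_eq_dfsLP (os : List OrbitX) (cands : List ℕ) (target x b c : ℕ)
    (table tableT : List LookRow) (roots : Fin cands.length → MCert cands.length) (k : ℕ)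
    (h : k < cands.length) :
    rootCheckBX os (.dfsLP cands target x b c table tableT roots) k =
      (roots ⟨k, h⟩).check (fun fm => lbOf2 (coreOf os) table tableT (setOf cands.length fm))
        target (target - 1) 1 (fun _ => ⟨k, h⟩) := by
  simp only [rootCheckBX, dif_pos h]

end Summit.MatrixMultiplication.OmegaCensus.GF2RankLB
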